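import Literature.ComputerArithmetic.BoldoJeannerodMelquiondMuller2023.TwoSum
import Literature.ComputerArithmetic.BoldoJeannerodMelquiondMuller2023.Ulp
import Literature.ComputerArithmetic.JeannerodRump2018.Theorem41
import Literature.ComputerArithmetic.JoldesMullerPopescu2017.DWTimesFP
import Literature.ComputerArithmetic.JoldesMullerPopescu2017.RoundedSumLowerBound
import Literature.ComputerArithmetic.LangeRump2018.Theorem10
import Mathlib.Algebra.Order.BigOperators.Group.List
import Mathlib.Tactic.FieldSimp

/-!
# Rump–Ogita–Oishi 2008: the unit in the first place `ufp`, `FastTwoSum` on the `2eps·ufp` grid, and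
# the error-free vector transformation `ExtractVector` (§2 eqs. (2.7)–(2.21), Lemma 2.6,
# Algorithm 3.2 / Lemma 3.3, Algorithm 3.4 / Theorem 3.5)

HONEST FRAMING (ENGINES group, unit `eng-quad-4`, kernels lane of the `certquad` engine — shared
numerical engines serving client cells; rigour lives in the verifiers; every published number
belongs to a client cell's ledger, not to the engines group): the lane's earlier anchors type the
compensated Horner / summation analyses in TRACE form (the format-level facts as hypotheses). This
file types and PROVES, at FORMAT LEVEL — over the tree's binary floating-point numbers
`JeannerodRump2018.IsFloat p emin` (precision `p`, gradual underflow from `emin`, NO overflow) and ANY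
round-to-nearest map `JeannerodRump2018.IsRoundNearest p emin fl` (no tie rule fixed), reusing the
`FastTwoSum` / `ulp` development of `BoldoJeannerodMelquiondMuller2023` — the "unit in the first place"
toolkit of §2 of the source and the error-free splitting `ExtractScalar` / `ExtractVector` of its §3, the
engine of the faithfully rounded summation `AccSum` (Algorithm 4.5 there; not typed here). No hardware,
vendor, timing or IEEE-format claims: `p ≥ 1` and `emin` are parameters.

Source read at the page: [RumpOgitaOishi2008] S. M. Rump, T. Ogita, S. Oishi, *Accurate floating-point
summation part I: faithful rounding*, SIAM J. Sci. Comput. 31(1) (2008) 189–224,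
doi:10.1137/050645671; read in the authors' version (33 pp.; its page numbers are used): p. 4 (§2:
`F`, `U`, `eps`, `eta`, eqs. (2.1)–(2.4)), p. 5 (eqs. (2.5)–(2.16); the definition (2.8) of `ufp`;
Fig. 2.1), p. 6 (eqs. (2.17)–(2.22) and the proofs of (2.16), (2.20), (2.21)), p. 8 (Algorithm 2.5
`FastTwoSum`), p. 9 (Lemma 2.6, the Remark after it, its proof, eqs. (2.27)–(2.28)), p. 12
(Algorithm 3.2 `ExtractScalar`, Lemma 3.3 with proof and the tie-to-even Remark, Algorithm 3.4
`ExtractVector`), p. 13 (Theorem 3.5, Remarks 1–2, proof).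

DICTIONARY (source ↦ here; carriers `ℚ`, every quantity of the source being rational).
* `F` ↦ `IsFloat p emin` (`f = m·2^e`, `|m| < 2^p`, `e ≥ emin`); `fl(·)` ↦ any `fl` with
  `IsRoundNearest p emin fl` (the source assumes IEEE 754 nearest, ties to even; everything below holds
  for every tie rule except where NOTE (a) says otherwise); "no overflow occurs, but we allow underflow"
  (p. 4) is literally the model (no `emax`).
* `eps` = "the distance from 1.0 to the next smaller floating-point number" = `2^-p` ↦
  `unitRoundoff p = 1/2^p` (`2^-53` in IEEE double, `p = 53`); `eta` = the smallest positive subnormal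
  ↦ `2^emin`; `½eps⁻¹eta` (smallest positive normal) ↦ `2^(emin + p - 1)`; `f ∈ U` ↦ `|f| ≤ 2^(emin+p-1)`.
* `ufp(r) = 2^⌊log₂|r|⌋` (`r ≠ 0`), `ufp(0) = 0` ↦ `ufp r` (format-free, defined for every rational;
  NOT the truncated `LangeRump2018.ufp` of the tree, which vanishes below the normal range).
* `r ∈ gℤ` ↦ `OnGrid g r` (`∃ m : ℤ, r = m·g`); `σ = 2^k`; `epsσℤ` ↦ `OnGrid (unitRoundoff p * 2^k)`,
  `= 2^(k-p)ℤ` (`u_mul_two_zpow`); `2^-M σ` ↦ `2^k / 2^M` (`= 2^(k-M)`).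
* The source's scalar / vector argument `p`, `pᵢ` of `ExtractScalar` / `ExtractVector` is renamed `x`,
  `xs` (`p` being the precision here); `n` ↦ `xs.length`; "`fl(Σ aᵢ)` in any order" ↦ the evaluation
  `t.eval fl` of a `JeannerodRump2018.SumTree` `t` with `t.leaves` = the summands; the loop
  `τ = fl(τ + qᵢ)` of Algorithm 3.4 ↦ `List.foldl` (its tree is the left comb `accTree (leaf 0) q`);
  `FastTwoSum` ↦ `BoldoJeannerodMelquiondMuller2023.fast2Sum`.

Typed and PROVED (all sorry-free; `[cite: …]` locators on every declaration):

* §2 toolkit — (2.8)/(2.9) `ufp`, `ufp_le_abs`, `abs_lt_two_mul_ufp`, `ufp_eq_two_zpow_of_le_of_lt`,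
  `ufp_mono`, `ufp_two_zpow`; (2.10) `ufp_le_ufp_of_ufp_le_abs`; (2.11) `OnGrid.of_le`; (2.12)
  `two_zpow_le_ufp`; (2.13) `onGrid_two_u_ufp_of_isFloat` (`f ∈ 2eps·ufp(f)ℤ`), `onGrid_eta_of_isFloat`
  (`F ⊆ etaℤ`), `onGrid_of_isFloat_of_le_abs`; (2.14) `isFloat_of_onGrid_of_abs_le` (`r ∈ epsσℤ`,
  `|r| ≤ σ`, `epsσ ≥ eta` ⟹ `r ∈ F`), `isFloat_of_onGrid_two_zpow`; (2.15) `onGrid_fl`, `onGrid_fl_add`;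
  (2.16) `onGrid_u_ufp_fl_add` (`a ≠ 0 ⟹ fl(a + b) ∈ eps·ufp(a)ℤ`); (2.17) `ufp_le_ufp_fl`; (2.18)
  `abs_fl_sub_le_u_ufp` (`|fl(r) - r| ≤ eps·ufp(r)` for `|r| ≥ ½eps⁻¹eta`); (2.19)
  `abs_fl_add_sub_le_u_ufp` (`|fl(a + b) - (a + b)| ≤ eps·ufp(a + b)`, no underflow unit),
  `ufp_add_le_ufp_fl_add`, `eta_le_abs_fl_add` (with (2.3): `fl(a + b) = 0 ⟹ a + b = 0`); (2.7)
  `lt_of_lt_fl`, `lt_of_fl_lt`; (2.20), first inequality, in any order: `abs_eval_le_length_mul`; (2.21)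
  `fl_add_eq_add_of_abs_fl_lt`, `fl_add_eq_add_of_abs_add_le`, and iterated in any order (the mechanism
  of Theorem 3.5): `eval_eq_exact_of_onGrid`. Also `ulp_eq_max` / `ulp_eq_two_mul_u_mul_ufp`
  (`ulp = max(eta, 2eps·ufp)`, joining the source's `ufp` to the tree's `ulp`).
* LEMMA 2.6 — `fastTwoSum_eft`: `a, b ∈ F`, `a ∈ 2eps·ufp(b)ℤ` ⟹ `fl(x - a) = x - a` and
  `y = b - q` exact (2.28), `x + y = a + b`, `|y| ≤ eps·ufp(a + b) ≤ eps·ufp(x)` (2.27); its heart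
  `isFloat_fl_add_sub_of_onGrid` (`fl(a + b) - a ∈ F`); the Remark `onGrid_two_u_ufp_of_abs_le`
  (`|b| ≤ |a|`, `b ≠ 0` ⟹ `a ∈ 2eps·ufp(b)ℤ`).
* ALGORITHM 3.2 `extractScalar` and LEMMA 3.3 — `extractScalar_eft` (`x = q + x′`, `|x′| ≤ epsσ`,
  `q ∈ epsσℤ`, both operations after the first exact; any `|x| ≤ σ`, any tie rule) and
  `abs_extractScalar_fst_le` (`|q| ≤ 2^-M σ` when `|x| ≤ 2^-M σ` and `M < p`; NOTE (a)).
* ALGORITHM 3.4 `extractVector` and THEOREM 3.5 — eq. (3.3) `extractVector_eft` (`Σ xᵢ = τ + Σ x′ᵢ`,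
  `max|x′ᵢ| ≤ epsσ`, `|τ| ≤ n2^-M σ < σ`, `τ ∈ epsσℤ`, and `τ = Σ qᵢ` exactly, `τ ∈ F`; hypotheses
  `n < 2^M`, `M < p`) and eq. (3.4) `abs_fl_extractVector_fst_add_lt` (`2^(2M)eps ≤ 1`, i.e. `2M ≤ p`
  ⟹ `|fl(τ + T)| < σ` for `T = fl(Σ x′ᵢ)` in ANY order).

NOTES. (a) TIE RULE. `IsRoundNearest` fixes no tie-breaking rule, and two printed clauses use ties to
even: Lemma 3.3's `|q| ≤ 2^-M σ` for `M ≥ p` (its Remark: "rounding tie to even is necessary") and,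
through it, Theorem 3.5 for `2^M·eps ≥ 1`. They FAIL for other nearest roundings: `p = 3`, `σ = 8`,
`M = 3`, `x = 1`, ties away from zero: `fl(9) = 10`, `q = 2 > 2^-M σ = 1`; and `xs = (1,1,1,1,1,-1)`
(`n = 6 < 2^M`) then makes the accumulation `τ` inexact (`fl(10 - 1) = fl(9) ≠ 9`). We therefore
state these clauses under `M < p` (`2^M·eps < 1`), where they hold for EVERY tie rule (the endpoints
`σ ± 2^-M σ` are then in `F`, or below `eta`), and note that every use in the source satisfies it:
(3.4) assumes `2^(2M)eps ≤ 1`, and `AccSum` takes `2^M = NextPowerTwo(n + 2)` under that assumption;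
Remark 2 after Theorem 3.5 observes that nothing is gained for `2^M·eps ≥ 1` anyway. This is a
restriction of two statements to the tie-rule-free regime, not a correction of the source.
(b) Lemma 2.6 is typed with its hypothesis read literally, `OnGrid (2 * unitRoundoff p * ufp b) a`;
for `b = 0` this grid is `{0}` (the case `|b| ≤ |a|` in general is the tree's `fast2Sum_correct`).
(c) The standard model (2.2)/(2.5) is not assumed: (2.18)/(2.19) are derived from nearest rounding and
(2.13)/(2.14) (`2eps·ufp`-neighbours are in `F`), and (2.3)/(2.4) come from the tree
(`isFloat_add_of_small`, `isFloat_add_sub_fl`).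
(d) NOT typed here: `TwoSum` (Algorithm 2.1; in the tree), Lemma 2.2, Definition 2.3 / Lemma 2.4
(faithful rounding; cf. the tree's `IsFaithful`), the second inequality of (2.20) and (2.22),
Algorithm 3.6 / Theorem 3.7 (`NextPowerTwo`), §4 (Algorithms 4.1 / 4.4 `Transform` and 4.5 `AccSum`,
Lemmas 4.2–4.3, Proposition 4.6 ff.), and Part II.
-/

namespace Literature.ComputerArithmetic.RumpOgitaOishi2008

open Literature.ComputerArithmetic.JeannerodRump2018
open Literature.ComputerArithmetic.JeannerodRump2018.SumTree
open Literature.ComputerArithmetic.BoldoJeannerodMelquiondMuller2023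
-- landed engine lemmas reused by name (`2^k ∈ F`, `|f| ≥ eta` for `f ∈ F \ {0}`, `|Σ| ≤ Σ|·|`):
open Literature.ComputerArithmetic.JoldesMullerPopescu2017 (isFloat_two_zpow two_zpow_emin_le_abs)
open Literature.ComputerArithmetic.LangeRump2018 (abs_list_sum_le)

variable {p : ℕ} {emin : ℤ} {fl : ℚ → ℚ}

/-- Powers of two are positive (used throughout for `σ = 2^k`, `eps·σ = 2^(k−p)`, `eta = 2^emin`).
[cite: RumpOgitaOishi2008, §2 (p. 193, "σ = 2^k")] -/
theorem two_zpow_pos (k : ℤ) : (0 : ℚ) < (2 : ℚ) ^ k := zpow_pos (by norm_num) k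

/-- Powers of two are nonzero. [cite: RumpOgitaOishi2008, §2 (p. 193, "σ = 2^k")] -/
theorem two_zpow_ne_zero (k : ℤ) : (2 : ℚ) ^ k ≠ 0 := (two_zpow_pos k).ne'

/-! ### §2, eq. (2.8)–(2.10): the unit in the first place -/

/-- **The unit in the first place** of a real (here: rational) number, eq. (2.8):
`ufp(r) = 2^⌊log₂|r|⌋` for `r ≠ 0`, `ufp(0) = 0` — "the value of the first nonzero bit in the binary
representation of `r`"; independent of any floating-point format. [cite: RumpOgitaOishi2008, §2 eq. (2.8)] -/
def ufp (r : ℚ) : ℚ := if r = 0 then 0 else (2 : ℚ) ^ Int.log 2 |r|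

/-- `ufp(0) = 0`. [cite: RumpOgitaOishi2008, §2 eq. (2.8)] -/
theorem ufp_zero : ufp 0 = 0 := by simp [ufp]

/-- `ufp(r) = 2^⌊log₂|r|⌋` for `r ≠ 0`. [cite: RumpOgitaOishi2008, §2 eq. (2.8)] -/
theorem ufp_of_ne_zero {r : ℚ} (hr : r ≠ 0) : ufp r = (2 : ℚ) ^ Int.log 2 |r| := by simp [ufp, hr]

/-- `ufp(r) ≥ 0`. [cite: RumpOgitaOishi2008, §2 eq. (2.8)] -/
theorem ufp_nonneg (r : ℚ) : 0 ≤ ufp r := by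
  by_cases hr : r = 0
  · simp [ufp, hr]
  · rw [ufp_of_ne_zero hr]; exact (two_zpow_pos _).le

/-- `ufp(r) > 0` for `r ≠ 0`. [cite: RumpOgitaOishi2008, §2 eq. (2.8)] -/
theorem ufp_pos {r : ℚ} (hr : r ≠ 0) : 0 < ufp r := by
  rw [ufp_of_ne_zero hr]; exact two_zpow_pos _

/-- `ufp(−r) = ufp(r)`. [cite: RumpOgitaOishi2008, §2 eq. (2.8)] -/
theorem ufp_neg (r : ℚ) : ufp (-r) = ufp r := by
  simp only [ufp, neg_eq_zero, abs_neg]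

/-- `ufp(|r|) = ufp(r)`. [cite: RumpOgitaOishi2008, §2 eq. (2.8)] -/
theorem ufp_abs (r : ℚ) : ufp |r| = ufp r := by
  simp only [ufp, abs_eq_zero, abs_abs]

/-- `ufp(2^k) = 2^k` (`σ = 2^k` is its own leading bit). [cite: RumpOgitaOishi2008, §2 eq. (2.8)] -/
theorem ufp_two_zpow (k : ℤ) : ufp ((2 : ℚ) ^ k) = (2 : ℚ) ^ k := by
  rw [ufp_of_ne_zero (two_zpow_ne_zero k), abs_of_pos (two_zpow_pos k)]
  congr 1
  exact_mod_cast Int.log_zpow (R := ℚ) (b := 2) (by norm_num) k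

/-- `ufp(r)` is a power of two for `r ≠ 0`. [cite: RumpOgitaOishi2008, §2 eq. (2.8)] -/
theorem exists_ufp_eq_two_zpow {r : ℚ} (hr : r ≠ 0) : ∃ e : ℤ, ufp r = (2 : ℚ) ^ e :=
  ⟨Int.log 2 |r|, ufp_of_ne_zero hr⟩

/-- Eq. (2.9), first half, valid for every `r`: `ufp(r) ≤ |r|`. [cite: RumpOgitaOishi2008, §2 eq. (2.9)] -/
theorem ufp_le_abs (r : ℚ) : ufp r ≤ |r| := by
  by_cases hr : r = 0
  · simp [ufp, hr]
  · rw [ufp_of_ne_zero hr]; exact zpow_log_le_abs hr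

/-- Eq. (2.9), second half: `0 ≠ r ⟹ |r| < 2·ufp(r)`. [cite: RumpOgitaOishi2008, §2 eq. (2.9)] -/
theorem abs_lt_two_mul_ufp {r : ℚ} (hr : r ≠ 0) : |r| < 2 * ufp r := by
  rw [ufp_of_ne_zero hr, mul_comm, ← zpow_add_one₀ (by norm_num : (2 : ℚ) ≠ 0)]
  exact abs_lt_zpow_log_succ r

/-- The binade characterisation: `2^e ≤ |r| < 2^(e+1) ⟹ ufp(r) = 2^e`.
[cite: RumpOgitaOishi2008, §2 eq. (2.8)–(2.9)] -/
theorem ufp_eq_two_zpow_of_le_of_lt {r : ℚ} {e : ℤ} (h1 : (2 : ℚ) ^ e ≤ |r|) (h2 : |r| < (2 : ℚ) ^ (e + 1)) :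
    ufp r = (2 : ℚ) ^ e := by
  have hpos : 0 < |r| := lt_of_lt_of_le (two_zpow_pos e) h1
  have hr : r ≠ 0 := abs_pos.mp hpos
  rw [ufp_of_ne_zero hr]
  congr 1
  have hge : e ≤ Int.log 2 |r| :=
    (Int.zpow_le_iff_le_log (b := 2) (by norm_num) hpos).mp (by exact_mod_cast h1)
  have hlt : Int.log 2 |r| < e + 1 :=
    (Int.lt_zpow_iff_log_lt (b := 2) (by norm_num) hpos).mp (by exact_mod_cast h2)
  omega

/-- `ufp` is monotone in `|r|`. [cite: RumpOgitaOishi2008, §2 eq. (2.10)] -/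
theorem ufp_mono {r r' : ℚ} (h : |r| ≤ |r'|) : ufp r ≤ ufp r' := by
  by_cases hr : r = 0
  · rw [hr, ufp_zero]; exact ufp_nonneg r'
  · have hr' : r' ≠ 0 := by
      intro h0; rw [h0, abs_zero] at h; exact hr (abs_nonpos_iff.mp h)
    rw [ufp_of_ne_zero hr, ufp_of_ne_zero hr']
    exact zpow_le_zpow_right₀ (by norm_num) (Int.log_mono_right (abs_pos.mpr hr) h)

/-- `ufp(ufp(r)) = ufp(r)`. [cite: RumpOgitaOishi2008, §2 eq. (2.8)] -/
theorem ufp_ufp (r : ℚ) : ufp (ufp r) = ufp r := by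
  by_cases hr : r = 0
  · rw [hr, ufp_zero, ufp_zero]
  · rw [ufp_of_ne_zero hr, ufp_two_zpow]

/-- Eq. (2.10): `ufp(r) ≤ |r'| ⟹ ufp(r) ≤ ufp(r')`. [cite: RumpOgitaOishi2008, §2 eq. (2.10)] -/
theorem ufp_le_ufp_of_ufp_le_abs {r r' : ℚ} (h : ufp r ≤ |r'|) : ufp r ≤ ufp r' := by
  have h' : |ufp r| ≤ |r'| := by rwa [abs_of_nonneg (ufp_nonneg r)]
  have := ufp_mono h'
  rwa [ufp_ufp] at this

/-- Eq. (2.12), which holds for every real: `2^k ≤ |r| ⟹ 2^k ≤ ufp(r)`.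
[cite: RumpOgitaOishi2008, §2 eq. (2.12)] -/
theorem two_zpow_le_ufp {r : ℚ} {k : ℤ} (h : (2 : ℚ) ^ k ≤ |r|) : (2 : ℚ) ^ k ≤ ufp r := by
  have := ufp_le_ufp_of_ufp_le_abs (r := (2 : ℚ) ^ k) (r' := r) (by rwa [ufp_two_zpow])
  rwa [ufp_two_zpow] at this

/-- `|r| < 2^(k+1) ⟹ ufp(r) ≤ 2^k` ("because `ufp(·)` is a power of 2", proof of (2.20)).
[cite: RumpOgitaOishi2008, §2 eq. (2.9)] -/
theorem ufp_le_two_zpow_of_abs_lt {r : ℚ} {k : ℤ} (h : |r| < (2 : ℚ) ^ (k + 1)) : ufp r ≤ (2 : ℚ) ^ k := by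
  by_cases hr : r = 0
  · rw [hr, ufp_zero]; exact (two_zpow_pos k).le
  · rw [ufp_of_ne_zero hr]
    have hlt : Int.log 2 |r| < k + 1 :=
      (Int.lt_zpow_iff_log_lt (b := 2) (by norm_num) (abs_pos.mpr hr)).mp (by exact_mod_cast h)
    exact zpow_le_zpow_right₀ (by norm_num) (by omega)

/-! ### The grids `eps·σ·ℤ` (scaled integers) and the dictionary `eps`, `eta` -/

/-- `r ∈ g·ℤ`: `r` is an integer multiple of `g` — the paper's sets `epsσℤ`, `2eps·ufp(f)ℤ`, `etaℤ`
("a set of fixed point numbers with smallest positive number `epsσ`").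
[cite: RumpOgitaOishi2008, §2 (p. 193, the set epsσℤ)] -/
def OnGrid (g r : ℚ) : Prop := ∃ m : ℤ, r = (m : ℚ) * g

/-- `0 ∈ gℤ`. [cite: RumpOgitaOishi2008, §2 (p. 193)] -/
theorem onGrid_zero (g : ℚ) : OnGrid g 0 := ⟨0, by simp⟩

/-- `g ∈ gℤ`. [cite: RumpOgitaOishi2008, §2 (p. 193)] -/
theorem onGrid_self (g : ℚ) : OnGrid g g := ⟨1, by simp⟩

/-- `gℤ` is closed under addition. [cite: RumpOgitaOishi2008, §2 (p. 193)] -/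
theorem OnGrid.add {g r s : ℚ} (hr : OnGrid g r) (hs : OnGrid g s) : OnGrid g (r + s) := by
  obtain ⟨m, rfl⟩ := hr; obtain ⟨n, rfl⟩ := hs
  exact ⟨m + n, by push_cast; ring⟩

/-- `gℤ` is closed under negation. [cite: RumpOgitaOishi2008, §2 (p. 193)] -/
theorem OnGrid.neg {g r : ℚ} (hr : OnGrid g r) : OnGrid g (-r) := by
  obtain ⟨m, rfl⟩ := hr
  exact ⟨-m, by push_cast; ring⟩

/-- `gℤ` is closed under subtraction. [cite: RumpOgitaOishi2008, §2 (p. 193)] -/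
theorem OnGrid.sub {g r s : ℚ} (hr : OnGrid g r) (hs : OnGrid g s) : OnGrid g (r - s) := by
  rw [sub_eq_add_neg]; exact hr.add hs.neg

/-- `gℤ` is closed under integer multiples. [cite: RumpOgitaOishi2008, §2 (p. 193)] -/
theorem OnGrid.int_mul {g r : ℚ} (hr : OnGrid g r) (n : ℤ) : OnGrid g ((n : ℚ) * r) := by
  obtain ⟨m, rfl⟩ := hr
  exact ⟨n * m, by push_cast; ring⟩

/-- A list sum of grid elements is a grid element. [cite: RumpOgitaOishi2008, §2 (p. 193)] -/
theorem onGrid_list_sum {g : ℚ} : ∀ {l : List ℚ}, (∀ r ∈ l, OnGrid g r) → OnGrid g l.sum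
  | [], _ => by simpa using onGrid_zero g
  | a :: l, h => by
      rw [List.sum_cons]
      exact (h a (by simp)).add (onGrid_list_sum fun r hr => h r (by simp [hr]))

/-- Eq. (2.11): a coarser dyadic grid lies inside a finer one, `2^m' ℤ ⊆ 2^m ℤ` for `m ≤ m'`.
[cite: RumpOgitaOishi2008, §2 eq. (2.11)] -/
theorem OnGrid.of_le {r : ℚ} {m m' : ℤ} (hr : OnGrid ((2 : ℚ) ^ m') r) (h : m ≤ m') :
    OnGrid ((2 : ℚ) ^ m) r := by
  obtain ⟨n, rfl⟩ := hr
  obtain ⟨d, hd⟩ := Int.eq_ofNat_of_zero_le (sub_nonneg.mpr h)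
  refine ⟨n * 2 ^ d, ?_⟩
  rw [show m' = m + (d : ℤ) by omega, zpow_add₀ (by norm_num : (2 : ℚ) ≠ 0), zpow_natCast]
  push_cast; ring

/-- "Of course, `F ⊆ etaℤ`": every float is an integer multiple of `eta = 2^emin`.
[cite: RumpOgitaOishi2008, §2 (p. 193)] -/
theorem onGrid_eta_of_isFloat {f : ℚ} (hf : IsFloat p emin f) : OnGrid ((2 : ℚ) ^ emin) f :=
  hf.exists_int_mul_zpow_emin

/-- The dictionary: `eps·2^L = 2^(L − p)` (`eps = 2^-p = unitRoundoff p`).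
[cite: RumpOgitaOishi2008, §2 (p. 192, eps = 2^-53 for binary64)] -/
theorem u_mul_two_zpow (L : ℤ) : unitRoundoff p * (2 : ℚ) ^ L = (2 : ℚ) ^ (L - p) := by
  rw [unitRoundoff, zpow_sub₀ (by norm_num : (2 : ℚ) ≠ 0), zpow_natCast]; ring

/-- The dictionary: `2eps·2^L = 2^(L − p + 1)`. [cite: RumpOgitaOishi2008, §2 (p. 192)] -/
theorem two_mul_u_mul_two_zpow (L : ℤ) : 2 * unitRoundoff p * (2 : ℚ) ^ L = (2 : ℚ) ^ (L - p + 1) := by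
  rw [zpow_add_one₀ (by norm_num : (2 : ℚ) ≠ 0), ← u_mul_two_zpow]; ring

/-- `eps > 0`. [cite: RumpOgitaOishi2008, §2 (p. 192)] -/
theorem u_pos : 0 < unitRoundoff p := by rw [unitRoundoff]; positivity

/-- `2^p · eps = 1`. [cite: RumpOgitaOishi2008, §2 (p. 192)] -/
theorem two_pow_mul_u : (2 : ℚ) ^ p * unitRoundoff p = 1 := by
  rw [unitRoundoff]; field_simp

/-- A nonzero element of a dyadic grid `2^eℤ` has magnitude at least `2^e`.
[cite: RumpOgitaOishi2008, §2 (p. 193, the set epsσℤ)] -/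
theorem two_zpow_le_abs_of_onGrid {r : ℚ} {e : ℤ} (hr : OnGrid ((2 : ℚ) ^ e) r) (h0 : r ≠ 0) :
    (2 : ℚ) ^ e ≤ |r| := by
  obtain ⟨N, hN⟩ := hr
  have hN0 : N ≠ 0 := by rintro rfl; simp at hN; exact h0 hN
  have h1 : (1 : ℚ) ≤ |(N : ℚ)| := by
    rw [← Int.cast_abs]; exact_mod_cast Int.one_le_abs hN0
  rw [hN, abs_mul, abs_of_pos (two_zpow_pos e)]
  calc (2 : ℚ) ^ e = 1 * (2 : ℚ) ^ e := (one_mul _).symm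
    _ ≤ |(N : ℚ)| * (2 : ℚ) ^ e := mul_le_mul_of_nonneg_right h1 (two_zpow_pos e).le

/-- A float of magnitude `< eta = 2^emin` is zero. [cite: RumpOgitaOishi2008, §2 (p. 192, eta)] -/
theorem eq_zero_of_isFloat_of_abs_lt {f : ℚ} (hf : IsFloat p emin f) (h : |f| < (2 : ℚ) ^ emin) : f = 0 := by
  by_contra h0
  exact absurd (two_zpow_emin_le_abs hf h0) (not_le.mpr h)

/-! ### §2, eq. (2.13)–(2.17): floats as scaled integers -/

/-- Eq. (2.13): `f ∈ F ⟹ f ∈ 2eps·ufp(f)ℤ` ("also true for `f ∈ U`", the underflow range).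
[cite: RumpOgitaOishi2008, §2 eq. (2.13)] -/
theorem onGrid_two_u_ufp_of_isFloat {f : ℚ} (hf : IsFloat p emin f) :
    OnGrid (2 * unitRoundoff p * ufp f) f := by
  by_cases h0 : f = 0
  · rw [h0]; exact onGrid_zero _
  · obtain ⟨K, hK⟩ := exists_eq_int_mul_two_zpow_of_isFloat hf (E := Int.log 2 |f|)
      (by rw [← ufp_of_ne_zero h0]; exact ufp_le_abs f)
    refine ⟨K, ?_⟩
    rw [ufp_of_ne_zero h0, two_mul_u_mul_two_zpow]
    exact hK

/-- Eq. (2.12)–(2.13) combined, the form used in proofs: a float of magnitude `≥ 2^E` lies on the grid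
`2eps·2^E·ℤ = 2^(E−p+1)ℤ`. [cite: RumpOgitaOishi2008, §2 eq. (2.12)–(2.13)] -/
theorem onGrid_of_isFloat_of_le_abs {f : ℚ} (hf : IsFloat p emin f) {E : ℤ} (hE : (2 : ℚ) ^ E ≤ |f|) :
    OnGrid ((2 : ℚ) ^ (E - p + 1)) f :=
  exists_eq_int_mul_two_zpow_of_isFloat hf hE

/-- Eq. (2.14): `r ∈ epsσℤ`, `|r| ≤ σ`, `epsσ ≥ eta` ⟹ `r ∈ F` (`σ = 2^k`).
[cite: RumpOgitaOishi2008, §2 eq. (2.14)] -/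
theorem isFloat_of_onGrid_of_abs_le (hp : 1 ≤ p) {r : ℚ} {k : ℤ}
    (hr : OnGrid (unitRoundoff p * (2 : ℚ) ^ k) r) (hle : |r| ≤ (2 : ℚ) ^ k)
    (heta : (2 : ℚ) ^ emin ≤ unitRoundoff p * (2 : ℚ) ^ k) : IsFloat p emin r := by
  rw [u_mul_two_zpow] at hr heta
  obtain ⟨m, rfl⟩ := hr
  have hk : emin ≤ k - p := (zpow_le_zpow_iff_right₀ (by norm_num : (1 : ℚ) < 2)).mp heta
  refine isFloat_of_abs_le hp ?_ hk
  have h2 : (0 : ℚ) < (2 : ℚ) ^ (k - p) := two_zpow_pos _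
  have hk' : (2 : ℚ) ^ k = (2 : ℚ) ^ p * (2 : ℚ) ^ (k - p) := by
    rw [← zpow_natCast, ← zpow_add₀ (by norm_num : (2 : ℚ) ≠ 0)]; congr 1; omega
  rw [abs_mul, abs_of_pos h2, hk'] at hle
  have : |(m : ℚ)| ≤ (2 : ℚ) ^ p := le_of_mul_le_mul_right hle h2
  rw [← Int.cast_abs] at this
  exact_mod_cast this

/-- The same on an explicit dyadic grid: `r ∈ 2^jℤ`, `|r| ≤ 2^p·2^j`, `j ≥ emin` ⟹ `r ∈ F`.
[cite: RumpOgitaOishi2008, §2 eq. (2.14)] -/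
theorem isFloat_of_onGrid_two_zpow (hp : 1 ≤ p) {r : ℚ} {j : ℤ} (hr : OnGrid ((2 : ℚ) ^ j) r)
    (hle : |r| ≤ (2 : ℚ) ^ p * (2 : ℚ) ^ j) (hj : emin ≤ j) : IsFloat p emin r := by
  obtain ⟨m, rfl⟩ := hr
  have h2 : (0 : ℚ) < (2 : ℚ) ^ j := two_zpow_pos _
  refine isFloat_of_abs_le hp ?_ hj
  rw [abs_mul, abs_of_pos h2] at hle
  have : |(m : ℚ)| ≤ (2 : ℚ) ^ p := le_of_mul_le_mul_right hle h2
  rw [← Int.cast_abs] at this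
  exact_mod_cast this

/-- Eq. (2.15), the mechanism: rounding to nearest preserves every dyadic grid `2^jℤ` — for ANY real
`t ∈ 2^jℤ`, `fl(t) ∈ 2^jℤ` (for `j ≥ emin` the two rounding candidates lie on the grid; for `j < emin`
because `F ⊆ etaℤ ⊆ 2^jℤ`). [cite: RumpOgitaOishi2008, §2 eq. (2.15)] -/
theorem onGrid_fl (hp : 1 ≤ p) (hfl : IsRoundNearest p emin fl) {j : ℤ} {t : ℚ}
    (ht : OnGrid ((2 : ℚ) ^ j) t) : OnGrid ((2 : ℚ) ^ j) (fl t) := by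
  rcases le_or_gt emin j with hj | hj
  · obtain ⟨N, rfl⟩ := ht
    exact exists_fl_eq_int_mul hp hfl N hj
  · exact (onGrid_eta_of_isFloat (hfl t).1).of_le hj.le

/-- Eq. (2.15): `a, b ∈ F ∩ epsσℤ` and `δ := fl(a + b) − (a + b)` ⟹ `fl(a + b), a + b, δ ∈ epsσℤ`
(`σ = 2^k`; the hypothesis `a, b ∈ F` is not even needed). [cite: RumpOgitaOishi2008, §2 eq. (2.15)] -/
theorem onGrid_fl_add (hp : 1 ≤ p) (hfl : IsRoundNearest p emin fl) {k : ℤ} {a b : ℚ}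
    (ha : OnGrid (unitRoundoff p * (2 : ℚ) ^ k) a) (hb : OnGrid (unitRoundoff p * (2 : ℚ) ^ k) b) :
    OnGrid (unitRoundoff p * (2 : ℚ) ^ k) (fl (a + b)) ∧ OnGrid (unitRoundoff p * (2 : ℚ) ^ k) (a + b) ∧
      OnGrid (unitRoundoff p * (2 : ℚ) ^ k) (fl (a + b) - (a + b)) := by
  rw [u_mul_two_zpow] at ha hb ⊢
  have hab : OnGrid ((2 : ℚ) ^ (k - p)) (a + b) := ha.add hb
  have hfl' := onGrid_fl hp hfl hab
  exact ⟨hfl', hab, hfl'.sub hab⟩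

/-- Eq. (2.16): `a, b ∈ F`, `a ≠ 0` ⟹ `fl(a + b) ∈ eps·ufp(a)ℤ` — for EVERY tie rule (the source argues
"without loss of generality `a ≥ b ≥ 0`" by symmetry; here directly: either `|b| ≥ ½ufp(a)` and both
summands lie on the grid, or `|a + b| > ½ufp(a) ∈ F` and so does `|fl(a + b)|`).
[cite: RumpOgitaOishi2008, §2 eq. (2.16)] -/
theorem onGrid_u_ufp_fl_add (hp : 1 ≤ p) (hfl : IsRoundNearest p emin fl) {a b : ℚ}
    (ha : IsFloat p emin a) (hb : IsFloat p emin b) (ha0 : a ≠ 0) :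
    OnGrid (unitRoundoff p * ufp a) (fl (a + b)) := by
  rw [ufp_of_ne_zero ha0, u_mul_two_zpow]
  set L : ℤ := Int.log 2 |a| with hL
  have hLa : (2 : ℚ) ^ L ≤ |a| := zpow_log_le_abs ha0
  rcases le_or_gt (L - p) emin with hle | hgt
  · -- the grid `2^(L-p)ℤ` contains `etaℤ ⊇ F`
    exact (onGrid_eta_of_isFloat (hfl (a + b)).1).of_le hle
  · rcases le_or_gt ((2 : ℚ) ^ (L - 1)) |b| with hbig | hsmall
    · -- `ufp(b) ≥ ½ufp(a)`: both `a` and `b` are on the grid `2^(L-p)ℤ`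
      have hb' : OnGrid ((2 : ℚ) ^ (L - p)) b := by
        have := onGrid_of_isFloat_of_le_abs hb hbig
        rwa [show L - 1 - (p : ℤ) + 1 = L - p by ring] at this
      have ha' : OnGrid ((2 : ℚ) ^ (L - p)) a :=
        (onGrid_of_isFloat_of_le_abs ha hLa).of_le (by omega)
      exact onGrid_fl hp hfl (ha'.add hb')
    · -- `|b| < ½ufp(a)`: `|a + b| > ½ufp(a) = 2^(L-1) ∈ F`, hence `|fl(a + b)| ≥ 2^(L-1)`
      have h2ne : (2 : ℚ) ≠ 0 := by norm_num
      have hhalf : (2 : ℚ) ^ L = 2 * (2 : ℚ) ^ (L - 1) := by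
        rw [show L = (L - 1) + 1 by ring, zpow_add_one₀ h2ne]; ring_nf
      have hsum : (2 : ℚ) ^ (L - 1) ≤ |a + b| := by
        have h1 : |a| ≤ |a + b| + |b| := by
          have := abs_add_le (a + b) (-b); simp at this; exact this
        linarith
      have hF : IsFloat p emin ((2 : ℚ) ^ (L - 1)) := isFloat_two_zpow hp (by omega)
      have hfl_ge : (2 : ℚ) ^ (L - 1) ≤ |fl (a + b)| := by
        have := abs_le_abs_fl hfl hF (t := a + b) (by rwa [abs_of_pos (two_zpow_pos _)])
        rwa [abs_of_pos (two_zpow_pos _)] at this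
      have := onGrid_of_isFloat_of_le_abs (hfl (a + b)).1 hfl_ge
      rwa [show L - 1 - (p : ℤ) + 1 = L - p by ring] at this

/-- `ufp(r) ≤ |fl(r)|` whenever `fl(r) ≠ 0` (below `eta` because a nonzero float is `≥ eta > |r|`;
above because `ufp(r) ∈ F` is a rounding candidate below `|r|`). [cite: RumpOgitaOishi2008, §2 eq. (2.17)] -/
theorem ufp_le_abs_fl (hp : 1 ≤ p) (hfl : IsRoundNearest p emin fl) {r : ℚ} (h : fl r ≠ 0) :
    ufp r ≤ |fl r| := by
  by_cases hr : r = 0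
  · rw [hr, ufp_zero]; exact abs_nonneg _
  rcases lt_or_ge |r| ((2 : ℚ) ^ emin) with hlt | hge
  · exact (ufp_le_abs r).trans (hlt.le.trans (two_zpow_emin_le_abs (hfl r).1 h))
  · have hlog : emin ≤ Int.log 2 |r| :=
      (Int.zpow_le_iff_le_log (b := 2) (by norm_num) (abs_pos.mpr hr)).mp (by exact_mod_cast hge)
    have hF : IsFloat p emin (ufp r) := by rw [ufp_of_ne_zero hr]; exact isFloat_two_zpow hp hlog
    have := abs_le_abs_fl hfl hF (t := r) (by rw [abs_of_nonneg (ufp_nonneg r)]; exact ufp_le_abs r)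
    rwa [abs_of_nonneg (ufp_nonneg r)] at this

/-- Eq. (2.17): `r̃ = fl(r) ≠ 0 ⟹ ufp(r) ≤ ufp(r̃)`. [cite: RumpOgitaOishi2008, §2 eq. (2.17)] -/
theorem ufp_le_ufp_fl (hp : 1 ≤ p) (hfl : IsRoundNearest p emin fl) {r : ℚ} (h : fl r ≠ 0) :
    ufp r ≤ ufp (fl r) :=
  ufp_le_ufp_of_ufp_le_abs (ufp_le_abs_fl hp hfl h)

/-! ### §2, eq. (2.18)–(2.19) and (2.21): the refined error estimate and exact additions -/

/-- In the normal range `ulp = 2eps·ufp`: `2^(emin+p−1) ≤ |t| ⟹ ulp(t) = 2·eps·ufp(t)` (the tree's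
`ulp` of [BoldoEtAl2023, Def. 2.4] versus the format-free `ufp`). [cite: RumpOgitaOishi2008, §2 (Fig. 2.1)] -/
theorem ulp_eq_two_mul_u_mul_ufp {t : ℚ} (ht : (2 : ℚ) ^ (emin + p - 1) ≤ |t|) :
    ulp p emin t = 2 * unitRoundoff p * ufp t := by
  have hpos : 0 < |t| := lt_of_lt_of_le (two_zpow_pos _) ht
  have ht0 : t ≠ 0 := abs_pos.mp hpos
  have hlog : emin + p - 1 ≤ Int.log 2 |t| :=
    (Int.zpow_le_iff_le_log (b := 2) (by norm_num) hpos).mp (by exact_mod_cast ht)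
  rw [ulp_of_ne_zero ht0, max_eq_right (by omega), ufp_of_ne_zero ht0, two_mul_u_mul_two_zpow]

/-- For nonzero `t`, `ulp(t) = max(eta, 2eps·ufp(t))`. [cite: RumpOgitaOishi2008, §2 (Fig. 2.1)] -/
theorem ulp_eq_max {t : ℚ} (ht0 : t ≠ 0) :
    ulp p emin t = max ((2 : ℚ) ^ emin) (2 * unitRoundoff p * ufp t) := by
  rw [ulp_of_ne_zero ht0, ufp_of_ne_zero ht0, two_mul_u_mul_two_zpow]
  rcases le_total emin (Int.log 2 |t| - p + 1) with h | h
  · rw [max_eq_right h, max_eq_right (zpow_le_zpow_right₀ (by norm_num) h)]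
  · rw [max_eq_left h, max_eq_left (zpow_le_zpow_right₀ (by norm_num) h)]

/-- Eq. (2.18), normal case, for a general real argument: `2^(emin+p−1) ≤ |r|` (so `fl(r) ∉ U`) ⟹
`|fl(r) − r| ≤ eps·ufp(r)`. [cite: RumpOgitaOishi2008, §2 eq. (2.18)] -/
theorem abs_fl_sub_le_u_ufp (hp : 1 ≤ p) (hfl : IsRoundNearest p emin fl) {r : ℚ}
    (hr : (2 : ℚ) ^ (emin + p - 1) ≤ |r|) : |fl r - r| ≤ unitRoundoff p * ufp r := by
  have := abs_sub_fl_le_half_ulp hp hfl r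
  rw [ulp_eq_two_mul_u_mul_ufp hr, abs_sub_comm] at this
  linarith

/-- Eq. (2.19), first inequality: for `a, b ∈ F`, `fl(a + b) = a + b + δ` with `|δ| ≤ eps·ufp(a + b)`
— "also true in the presence of underflow because in this case `δ = 0`, the addition is exact" (eq. (2.3)).
[cite: RumpOgitaOishi2008, §2 eq. (2.19)] -/
theorem abs_fl_add_sub_le_u_ufp (hp : 1 ≤ p) (hfl : IsRoundNearest p emin fl) {a b : ℚ}
    (ha : IsFloat p emin a) (hb : IsFloat p emin b) :
    |fl (a + b) - (a + b)| ≤ unitRoundoff p * ufp (a + b) := by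
  rcases lt_or_ge |a + b| ((2 : ℚ) ^ (emin + p - 1)) with hlt | hge
  · have hsmall : |a + b| < (2 : ℚ) ^ (emin + p) :=
      hlt.trans (zpow_lt_zpow_right₀ (by norm_num) (by omega))
    rw [fl_eq_self hfl (isFloat_add_of_small ha hb hsmall), sub_self, abs_zero]
    exact mul_nonneg u_pos.le (ufp_nonneg _)
  · exact abs_fl_sub_le_u_ufp hp hfl hge

/-- Eq. (2.19), second inequality: `eps·ufp(a + b) ≤ eps·ufp(fl(a + b))` for `a, b ∈ F` (if `a + b ≠ 0`
then `|a + b| ≥ eta ∈ F`, so `fl(a + b) ≠ 0` and (2.17) applies). [cite: RumpOgitaOishi2008, §2 eq. (2.19)] -/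
theorem ufp_add_le_ufp_fl_add (hp : 1 ≤ p) (hfl : IsRoundNearest p emin fl) {a b : ℚ}
    (ha : IsFloat p emin a) (hb : IsFloat p emin b) : ufp (a + b) ≤ ufp (fl (a + b)) := by
  by_cases h0 : a + b = 0
  · rw [h0, ufp_zero]; exact ufp_nonneg _
  · refine ufp_le_ufp_fl hp hfl ?_
    obtain ⟨N, hN⟩ := exists_int_add ha hb
    have hge : (2 : ℚ) ^ emin ≤ |a + b| := two_zpow_le_abs_of_onGrid ⟨N, hN⟩ h0
    intro hz
    have := abs_le_abs_fl hfl (isFloat_two_zpow hp le_rfl) (t := a + b)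
      (by rwa [abs_of_pos (two_zpow_pos emin)])
    rw [hz, abs_zero, abs_of_pos (two_zpow_pos emin)] at this
    exact absurd this (not_le.mpr (two_zpow_pos emin))

/-- Eq. (2.19), third inequality: `eps·ufp(f) ≤ eps·|f|`. [cite: RumpOgitaOishi2008, §2 eq. (2.19)] -/
theorem u_mul_ufp_le_u_mul_abs (f : ℚ) : unitRoundoff p * ufp f ≤ unitRoundoff p * |f| :=
  mul_le_mul_of_nonneg_left (ufp_le_abs f) u_pos.le

/-- `|fl(a + b)| ≥ eta` as soon as `a + b ≠ 0` (`a, b ∈ F`: the sum is a nonzero element of `etaℤ`, and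
`eta ∈ F` is a rounding candidate); in particular `fl(a + b) = 0 ⟹ a + b = 0`.
[cite: RumpOgitaOishi2008, §2 eq. (2.3) and (2.19)] -/
theorem eta_le_abs_fl_add (hp : 1 ≤ p) (hfl : IsRoundNearest p emin fl) {a b : ℚ}
    (ha : IsFloat p emin a) (hb : IsFloat p emin b) (h0 : a + b ≠ 0) : (2 : ℚ) ^ emin ≤ |fl (a + b)| := by
  obtain ⟨N, hN⟩ := exists_int_add ha hb
  have hge : (2 : ℚ) ^ emin ≤ |a + b| := two_zpow_le_abs_of_onGrid ⟨N, hN⟩ h0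
  have := abs_le_abs_fl hfl (isFloat_two_zpow hp le_rfl) (t := a + b)
    (by rwa [abs_of_pos (two_zpow_pos emin)])
  rwa [abs_of_pos (two_zpow_pos emin)] at this

/-- Eq. (2.7) (a consequence of the monotonicity (2.6) of rounding): for `f ∈ F`, `f < fl(r) ⟹ f < r`.
[cite: RumpOgitaOishi2008, §2 eq. (2.7)] -/
theorem lt_of_lt_fl (hfl : IsRoundNearest p emin fl) {f r : ℚ} (hf : IsFloat p emin f) (h : f < fl r) :
    f < r := by
  by_contra hle
  exact absurd (fl_le_of_le hfl hf (not_lt.mp hle)) (not_le.mpr h)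

/-- Eq. (2.7), other side: for `f ∈ F`, `fl(r) < f ⟹ r < f`. [cite: RumpOgitaOishi2008, §2 eq. (2.7)] -/
theorem lt_of_fl_lt (hfl : IsRoundNearest p emin fl) {f r : ℚ} (hf : IsFloat p emin f) (h : fl r < f) :
    r < f := by
  by_contra hle
  exact absurd (le_fl_of_le hfl hf (not_lt.mp hle)) (not_le.mpr h)

/-- Eq. (2.21), second part: `a, b ∈ F ∩ epsσℤ` and `|a + b| ≤ σ` ⟹ `fl(a + b) = a + b` (`σ = 2^k`; if
`epsσ ≥ eta` by (2.14), otherwise `σ < eps⁻¹eta` and the addition is exact by (2.3)).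
[cite: RumpOgitaOishi2008, §2 eq. (2.21)] -/
theorem fl_add_eq_add_of_abs_add_le (hp : 1 ≤ p) (hfl : IsRoundNearest p emin fl) {k : ℤ} {a b : ℚ}
    (ha : IsFloat p emin a) (hb : IsFloat p emin b) (ha' : OnGrid (unitRoundoff p * (2 : ℚ) ^ k) a)
    (hb' : OnGrid (unitRoundoff p * (2 : ℚ) ^ k) b) (hab : |a + b| ≤ (2 : ℚ) ^ k) : fl (a + b) = a + b := by
  refine fl_eq_self hfl ?_
  rcases le_or_gt ((2 : ℚ) ^ emin) (unitRoundoff p * (2 : ℚ) ^ k) with heta | hlt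
  · exact isFloat_of_onGrid_of_abs_le hp (ha'.add hb') hab heta
  · rw [u_mul_two_zpow] at hlt
    have hk : k - p < emin := (zpow_lt_zpow_iff_right₀ (by norm_num : (1 : ℚ) < 2)).mp hlt
    exact isFloat_add_of_small ha hb (hab.trans_lt (zpow_lt_zpow_right₀ (by norm_num) (by omega)))

/-- Eq. (2.21), first part: `a, b ∈ F ∩ epsσℤ` and `|fl(a + b)| < σ` ⟹ `fl(a + b) = a + b` (by (2.7),
`|fl(a + b)| < σ` forces `|a + b| < σ` when `σ ∈ F`; when `σ < eta` it forces `fl(a + b) = 0 = a + b`).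
[cite: RumpOgitaOishi2008, §2 eq. (2.21)] -/
theorem fl_add_eq_add_of_abs_fl_lt (hp : 1 ≤ p) (hfl : IsRoundNearest p emin fl) {k : ℤ} {a b : ℚ}
    (ha : IsFloat p emin a) (hb : IsFloat p emin b) (ha' : OnGrid (unitRoundoff p * (2 : ℚ) ^ k) a)
    (hb' : OnGrid (unitRoundoff p * (2 : ℚ) ^ k) b) (hab : |fl (a + b)| < (2 : ℚ) ^ k) :
    fl (a + b) = a + b := by
  rcases le_or_gt emin k with hk | hk
  · have hσ : IsFloat p emin ((2 : ℚ) ^ k) := isFloat_two_zpow hp hk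
    obtain ⟨hlo, hhi⟩ := abs_lt.mp hab
    have h1 : a + b < (2 : ℚ) ^ k := lt_of_fl_lt hfl hσ hhi
    have h2 : -(2 : ℚ) ^ k < a + b := lt_of_lt_fl hfl hσ.neg hlo
    exact fl_add_eq_add_of_abs_add_le hp hfl ha hb ha' hb' (abs_lt.mpr ⟨h2, h1⟩).le
  · have h0 : fl (a + b) = 0 :=
      eq_zero_of_isFloat_of_abs_lt (hfl _).1 (hab.trans (zpow_lt_zpow_right₀ (by norm_num) hk))
    by_contra hne
    rw [h0] at hne
    have := eta_le_abs_fl_add hp hfl ha hb (Ne.symm hne)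
    rw [h0, abs_zero] at this
    exact absurd this (not_le.mpr (two_zpow_pos emin))

/-! ### Algorithm 2.5 `FastTwoSum` and Lemma 2.6 -/

/-- The Remark after Lemma 2.6: `|a| ≥ |b|` (and `b ≠ 0`) implies `ufp(a) ≥ ufp(b)` and hence, by (2.13)
and (2.11), `a ∈ 2eps·ufp(b)ℤ` — Dekker's hypothesis is a special case of Lemma 2.6's.
[cite: RumpOgitaOishi2008, Remark after Lemma 2.6] -/
theorem onGrid_two_u_ufp_of_abs_le {a b : ℚ} (ha : IsFloat p emin a) (hb0 : b ≠ 0) (hba : |b| ≤ |a|) :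
    OnGrid (2 * unitRoundoff p * ufp b) a := by
  have ha0 : a ≠ 0 := by
    intro h; rw [h, abs_zero] at hba; exact hb0 (abs_nonpos_iff.mp hba)
  have hlog : Int.log 2 |b| ≤ Int.log 2 |a| := Int.log_mono_right (abs_pos.mpr hb0) hba
  rw [ufp_of_ne_zero hb0, two_mul_u_mul_two_zpow]
  have := onGrid_two_u_ufp_of_isFloat ha
  rw [ufp_of_ne_zero ha0, two_mul_u_mul_two_zpow] at this
  exact this.of_le (by omega)

/-- The exact middle subtraction of `FastTwoSum` under Lemma 2.6's hypothesis `a ∈ 2eps·ufp(b)ℤ`: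
`fl(a + b) − a ∈ F`. Either `|b| ≤ |a|` (Dekker / Sterbenz), or `|a| < |b|` and then `a` fits on the
quantum `ulp(b)` of `b` with a `p`-bit significand (same-quantum case of [BoldoEtAl2023, §2.4]).
[cite: RumpOgitaOishi2008, Lemma 2.6 eq. (2.28)] -/
theorem isFloat_fl_add_sub_of_onGrid (hp : 1 ≤ p) (hfl : IsRoundNearest p emin fl) {a b : ℚ}
    (ha : IsFloat p emin a) (hb : IsFloat p emin b) (hab : OnGrid (2 * unitRoundoff p * ufp b) a) :
    IsFloat p emin (fl (a + b) - a) := by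
  rcases le_or_gt |b| |a| with hba | hlt
  · exact isFloat_fl_add_sub_left hfl ha hb hba
  · have hb0 : b ≠ 0 := by
      intro h; rw [h, abs_zero] at hlt; exact (not_lt.mpr (abs_nonneg a)) hlt
    obtain ⟨e, he, hu⟩ := exists_ulp_eq_two_zpow (p := p) (emin := emin) b
    have h2e := two_zpow_pos e
    -- `a ∈ ulp(b)ℤ`, `ulp(b) = max(eta, 2eps·ufp(b)) = 2^e`
    have ha' : OnGrid (ulp p emin b) a := by
      rw [ulp_eq_max hb0]
      rcases le_total ((2 : ℚ) ^ emin) (2 * unitRoundoff p * ufp b) with h | h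
      · rw [max_eq_right h]; exact hab
      · rw [max_eq_left h]; exact onGrid_eta_of_isFloat ha
    rw [hu] at ha'
    obtain ⟨m, hm⟩ := ha'
    obtain ⟨K, hK⟩ := exists_eq_int_mul_ulp_of_isFloat hb
    rw [hu] at hK
    have hblt : |b| < 2 ^ p * (2 : ℚ) ^ e := by
      have := abs_lt_two_pow_mul_ulp (p := p) (emin := emin) b; rwa [hu] at this
    have hK' : |K| < 2 ^ p := by
      have h1 : |(K : ℚ)| * (2 : ℚ) ^ e < 2 ^ p * (2 : ℚ) ^ e := by
        have := hblt; rwa [hK, abs_mul, abs_of_pos h2e] at this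
      have h2 : |(K : ℚ)| < 2 ^ p := lt_of_mul_lt_mul_right h1 h2e.le
      rw [← Int.cast_abs] at h2; exact_mod_cast h2
    have hm' : |m| < 2 ^ p := by
      have h1 : |(m : ℚ)| * (2 : ℚ) ^ e < 2 ^ p * (2 : ℚ) ^ e := by
        calc |(m : ℚ)| * (2 : ℚ) ^ e = |a| := by rw [hm, abs_mul, abs_of_pos h2e]
          _ < |b| := hlt
          _ < 2 ^ p * (2 : ℚ) ^ e := hblt
      have h2 : |(m : ℚ)| < 2 ^ p := lt_of_mul_lt_mul_right h1 h2e.le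
      rw [← Int.cast_abs] at h2; exact_mod_cast h2
    rw [hm, hK]
    exact isFloat_fl_add_sub_left_of_sameQuantum hp hfl hm' hK' he

/-- **LEMMA 2.6** (`FastTwoSum` = [BoldoEtAl2023, Algorithm 1] `fast2Sum fl a b = (x, y)`,
`x = fl(a + b)`, `q = fl(x − a)`, `y = fl(b − q)`). Let `a, b ∈ F` with `a ∈ 2eps·ufp(b)ℤ`. Then
`q = fl(x − a) = x − a` and `y = fl(b − q) = b − q` are exact (2.28), `x + y = a + b`, and
`|y| ≤ eps·ufp(a + b) ≤ eps·ufp(x)` (2.27) — precision `p ≥ 1`, gradual underflow, ANY tie rule, no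
overflow in this model. (Read literally, `b = 0` forces `a = 0` in the hypothesis since `ufp(0) = 0`; the
case `|b| ≤ |a|` in full is [BoldoEtAl2023]'s `fast2Sum_correct`.) [cite: RumpOgitaOishi2008, Lemma 2.6] -/
theorem fastTwoSum_eft (hp : 1 ≤ p) (hfl : IsRoundNearest p emin fl) {a b : ℚ}
    (ha : IsFloat p emin a) (hb : IsFloat p emin b) (hab : OnGrid (2 * unitRoundoff p * ufp b) a) :
    fl (fl (a + b) - a) = fl (a + b) - a ∧
      (fast2Sum fl a b).2 = b - fl (fl (a + b) - a) ∧
      (fast2Sum fl a b).1 + (fast2Sum fl a b).2 = a + b ∧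
      |(fast2Sum fl a b).2| ≤ unitRoundoff p * ufp (a + b) ∧
      unitRoundoff p * ufp (a + b) ≤ unitRoundoff p * ufp (fast2Sum fl a b).1 := by
  obtain ⟨h1, h2, h3⟩ :=
    fast2Sum_correct_of_isFloat_sub hp hfl ha hb (isFloat_fl_add_sub_of_onGrid hp hfl ha hb hab)
  refine ⟨h1, by rw [h2, h1]; ring, h3, ?_, ?_⟩
  · rw [h2, abs_sub_comm]; exact abs_fl_add_sub_le_u_ufp hp hfl ha hb
  · exact mul_le_mul_of_nonneg_left (ufp_add_le_ufp_fl_add hp hfl ha hb) u_pos.le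

/-! ### Algorithm 3.2 `ExtractScalar` and Lemma 3.3 -/

/-- **Algorithm 3.2** `[q, p′] = ExtractScalar(σ, p)`: `q = fl((σ + p) − σ)`, `p′ = fl(p − q)` — "a
floating-point number is split relative to `σ`, a fixed power of 2" (the input `p` of the source is our `x`,
`p` being the precision). [cite: RumpOgitaOishi2008, Algorithm 3.2] -/
def extractScalar (fl : ℚ → ℚ) (σ x : ℚ) : ℚ × ℚ :=
  (fl (fl (σ + x) - σ), fl (x - fl (fl (σ + x) - σ)))

/-- The components of `ExtractScalar`. [cite: RumpOgitaOishi2008, Algorithm 3.2] -/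
theorem extractScalar_eq (fl : ℚ → ℚ) (σ x : ℚ) :
    extractScalar fl σ x = (fl (fl (σ + x) - σ), fl (x - fl (fl (σ + x) - σ))) := rfl

/-- "`ExtractScalar(σ, p)` performs exactly the same operations in the same order as `FastTwoSum(σ, p)`":
its low part is `FastTwoSum`'s correction term. [cite: RumpOgitaOishi2008, proof of Lemma 3.3] -/
theorem extractScalar_snd_eq_fast2Sum_snd (fl : ℚ → ℚ) (σ x : ℚ) :
    (extractScalar fl σ x).2 = (fast2Sum fl σ x).2 := rfl

/-- Both outputs of `ExtractScalar` are floating-point numbers (they are rounded values).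
[cite: RumpOgitaOishi2008, Algorithm 3.2] -/
theorem isFloat_extractScalar (hfl : IsRoundNearest p emin fl) (σ x : ℚ) :
    IsFloat p emin (extractScalar fl σ x).1 ∧ IsFloat p emin (extractScalar fl σ x).2 :=
  ⟨(hfl _).1, (hfl _).1⟩

/-- **LEMMA 3.3, eq. (3.2) without the tie-rule-dependent clause.** `σ = 2^k ∈ F` (`k ≥ emin`), `x ∈ F`,
`|x| ≤ σ`, `[q, x′] = ExtractScalar(σ, x)`. Then the subtraction `q = fl(σ + x) − σ` is exact, `x′ = x − q`
is exact, `x = q + x′`, `|x′| ≤ eps·σ`, and `q ∈ epsσℤ` — for ANY round-to-nearest tie rule (proof as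
printed: Lemma 2.6 with `|x| ≤ σ`; `|x′| ≤ eps·ufp(σ + x) ≤ epsσ` by (2.27) unless `|x| = σ`, when
`x′ = 0`; `q ∈ epsσℤ` by (2.16)). [cite: RumpOgitaOishi2008, Lemma 3.3 eq. (3.2)] -/
theorem extractScalar_eft (hp : 1 ≤ p) (hfl : IsRoundNearest p emin fl) {k : ℤ} (hk : emin ≤ k)
    {x : ℚ} (hx : IsFloat p emin x) (hxs : |x| ≤ (2 : ℚ) ^ k) :
    (extractScalar fl ((2 : ℚ) ^ k) x).1 = fl ((2 : ℚ) ^ k + x) - (2 : ℚ) ^ k ∧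
      (extractScalar fl ((2 : ℚ) ^ k) x).2 = x - (extractScalar fl ((2 : ℚ) ^ k) x).1 ∧
      x = (extractScalar fl ((2 : ℚ) ^ k) x).1 + (extractScalar fl ((2 : ℚ) ^ k) x).2 ∧
      |(extractScalar fl ((2 : ℚ) ^ k) x).2| ≤ unitRoundoff p * (2 : ℚ) ^ k ∧
      OnGrid (unitRoundoff p * (2 : ℚ) ^ k) (extractScalar fl ((2 : ℚ) ^ k) x).1 := by
  set σ : ℚ := (2 : ℚ) ^ k with hσ
  have hσF : IsFloat p emin σ := isFloat_two_zpow hp hk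
  have hσpos : 0 < σ := two_zpow_pos k
  have hba : |x| ≤ |σ| := by rwa [abs_of_pos hσpos]
  obtain ⟨hq, hy, -⟩ := fast2Sum_correct hp hfl hσF hx hba
  have h1 : (extractScalar fl σ x).1 = fl (σ + x) - σ := hq
  have h2 : (extractScalar fl σ x).2 = σ + x - fl (σ + x) := hy
  refine ⟨h1, by rw [h1, h2]; ring, by rw [h1, h2]; ring, ?_, ?_⟩
  · -- `|x′| ≤ eps·σ`
    rw [h2, show σ + x - fl (σ + x) = -(fl (σ + x) - (σ + x)) by ring, abs_neg]
    rcases hxs.lt_or_eq with hlt | heq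
    · refine (abs_fl_add_sub_le_u_ufp hp hfl hσF hx).trans (mul_le_mul_of_nonneg_left ?_ u_pos.le)
      apply ufp_le_two_zpow_of_abs_lt
      calc |σ + x| ≤ |σ| + |x| := abs_add_le σ x
        _ < σ + σ := by rw [abs_of_pos hσpos]; linarith
        _ = (2 : ℚ) ^ (k + 1) := by rw [hσ, zpow_add_one₀ (by norm_num : (2 : ℚ) ≠ 0)]; ring
    · have hexact : IsFloat p emin (σ + x) := by
        rcases (abs_eq hσpos.le).mp heq with h | h
        · rw [h, ← two_mul]; exact isFloat_two_mul hσF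
        · rw [h, add_neg_cancel]; exact isFloat_zero p emin
      rw [fl_eq_self hfl hexact, sub_self, abs_zero]
      exact mul_nonneg u_pos.le hσpos.le
  · -- `q ∈ epsσℤ` by (2.16) applied to `a = σ ≠ 0`, `b = x`
    rw [h1]
    have h216 := onGrid_u_ufp_fl_add hp hfl hσF hx hσpos.ne'
    have hufp : ufp σ = σ := by rw [hσ]; exact ufp_two_zpow k
    rw [hufp] at h216
    refine h216.sub ⟨2 ^ p, ?_⟩
    push_cast
    rw [← mul_assoc, two_pow_mul_u, one_mul]

/-- **LEMMA 3.3, the clause `|q| ≤ 2^-M σ`.** If moreover `|x| ≤ 2^-M σ` with `M < p` (i.e. `2^M·eps < 1`),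
then `|q| ≤ 2^-M σ` for ANY tie rule: `σ ± 2^-M σ = (2^M ± 1)·2^(k−M)` are then floating-point numbers
(or `2^(k−M) < eta` and `x = 0`), so the first case of the printed proof applies via the monotonicity (2.6).
The source proves the clause for every `M ≥ 0` using rounding TIES TO EVEN (its Remark: "rounding tie to
even is necessary to ensure `|q| ≤ 2^-M σ`"); for a general nearest rounding it fails when `M ≥ p`
(`p = 3`, `σ = 8`, `M = 3`, `x = 1`, ties away: `fl(9) = 10`, `q = 2`). Every use in the source has
`2^(2M)·eps ≤ 1`, hence `M < p`. [cite: RumpOgitaOishi2008, Lemma 3.3 eq. (3.2) and Remark] -/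
theorem abs_extractScalar_fst_le (hp : 1 ≤ p) (hfl : IsRoundNearest p emin fl) {k : ℤ} (hk : emin ≤ k)
    {x : ℚ} (hx : IsFloat p emin x) {M : ℕ} (hM : M < p) (hxM : |x| ≤ (2 : ℚ) ^ k / 2 ^ M) :
    |(extractScalar fl ((2 : ℚ) ^ k) x).1| ≤ (2 : ℚ) ^ k / 2 ^ M := by
  have hdiv : (2 : ℚ) ^ k / 2 ^ M = (2 : ℚ) ^ (k - M) := by
    rw [zpow_sub₀ (by norm_num : (2 : ℚ) ≠ 0), zpow_natCast]
  rw [hdiv] at hxM ⊢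
  have hxs : |x| ≤ (2 : ℚ) ^ k := hxM.trans (zpow_le_zpow_right₀ (by norm_num) (by omega))
  obtain ⟨h1, -⟩ := extractScalar_eft hp hfl hk hx hxs
  rw [h1]
  rcases lt_or_ge (k - (M : ℤ)) emin with hlt | hge
  · -- `2^(k−M) < eta`: then `x = 0` and `q = fl(σ) − σ = 0`
    have hx0 : x = 0 :=
      eq_zero_of_isFloat_of_abs_lt hx (hxM.trans_lt (zpow_lt_zpow_right₀ (by norm_num) hlt))
    rw [hx0, add_zero, fl_eq_self hfl (isFloat_two_zpow hp hk), sub_self, abs_zero]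
    exact (two_zpow_pos _).le
  · -- the floating-point interval `[σ − 2^(k−M), σ + 2^(k−M)]` contains `σ + x`, hence `fl(σ + x)`
    have h2M : (2 : ℚ) ^ k = (2 : ℚ) ^ M * (2 : ℚ) ^ (k - M) := by
      rw [← zpow_natCast, ← zpow_add₀ (by norm_num : (2 : ℚ) ≠ 0)]; congr 1; ring
    have hMp : (2 : ℤ) ^ M < 2 ^ p := pow_lt_pow_right₀ (by norm_num) hM
    have h1M : (1 : ℤ) ≤ 2 ^ M := one_le_pow₀ (by norm_num)
    have hU : IsFloat p emin ((((2 : ℤ) ^ M + 1 : ℤ) : ℚ) * (2 : ℚ) ^ (k - M)) := by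
      refine isFloat_of_abs_le hp ?_ hge
      rw [abs_of_nonneg (by omega)]; omega
    have hL : IsFloat p emin ((((2 : ℤ) ^ M - 1 : ℤ) : ℚ) * (2 : ℚ) ^ (k - M)) := by
      refine isFloat_of_int_mul _ _ ?_ hge
      rw [abs_of_nonneg (by omega)]; omega
    have hUeq : (((2 : ℤ) ^ M + 1 : ℤ) : ℚ) * (2 : ℚ) ^ (k - M) = (2 : ℚ) ^ k + (2 : ℚ) ^ (k - M) := by
      rw [h2M]; push_cast; ring
    have hLeq : (((2 : ℤ) ^ M - 1 : ℤ) : ℚ) * (2 : ℚ) ^ (k - M) = (2 : ℚ) ^ k - (2 : ℚ) ^ (k - M) := by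
      rw [h2M]; push_cast; ring
    rw [hUeq] at hU
    rw [hLeq] at hL
    obtain ⟨hxlo, hxhi⟩ := abs_le.mp hxM
    have hlo := le_fl_of_le hfl hL (t := (2 : ℚ) ^ k + x) (by linarith)
    have hhi := fl_le_of_le hfl hU (t := (2 : ℚ) ^ k + x) (by linarith)
    rw [abs_le]; constructor <;> linarith

/-! ### Exact and bounded floating-point sums in any order (eq. (2.20), (2.21) iterated) -/

/-- A sum, in any order, of numbers on a common grid `gℤ` is on the grid.
[cite: RumpOgitaOishi2008, proof of Theorem 3.5 ("so τ ∈ epsσℤ")] -/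
theorem onGrid_exact {g : ℚ} : ∀ t : SumTree, (∀ a ∈ t.leaves, OnGrid g a) → OnGrid g t.exact
  | .leaf a, h => h a (by simp [leaves])
  | .node l r, h => by
      simp only [exact]
      exact (onGrid_exact l fun a ha => h a (by simp [leaves, ha])).add
        (onGrid_exact r fun a ha => h a (by simp [leaves, ha]))

/-- EXACT SUMMATION IN ANY ORDER (eq. (2.21) iterated, the mechanism of Theorem 3.5): if the summands lie
on a dyadic grid `2^jℤ` with `j ≥ emin` and `Σ|aᵢ| ≤ 2^p·2^j` (`= σ` for the grid `epsσℤ`), then EVERY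
evaluation order of the floating-point sum returns the exact sum — each partial sum is on the grid and of
magnitude `≤ σ`, hence in `F` by (2.14). [cite: RumpOgitaOishi2008, eq. (2.21) and proof of Theorem 3.5] -/
theorem eval_eq_exact_of_onGrid (hp : 1 ≤ p) (hfl : IsRoundNearest p emin fl) {j : ℤ} (hj : emin ≤ j) :
    ∀ t : SumTree, (∀ a ∈ t.leaves, OnGrid ((2 : ℚ) ^ j) a) → t.absSum ≤ (2 : ℚ) ^ p * (2 : ℚ) ^ j →
      t.eval fl = t.exact
  | .leaf a, _, _ => rfl
  | .node l r, hg, hs => by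
      have hgl : ∀ a ∈ l.leaves, OnGrid ((2 : ℚ) ^ j) a := fun a ha => hg a (by simp [leaves, ha])
      have hgr : ∀ a ∈ r.leaves, OnGrid ((2 : ℚ) ^ j) a := fun a ha => hg a (by simp [leaves, ha])
      have habs := abs_exact_le_absSum (.node l r)
      rw [absSum_node] at hs habs
      have hl := eval_eq_exact_of_onGrid hp hfl hj l hgl (by linarith [absSum_nonneg r])
      have hr := eval_eq_exact_of_onGrid hp hfl hj r hgr (by linarith [absSum_nonneg l])
      simp only [eval, exact] at habs ⊢
      rw [hl, hr]
      exact fl_eq_self hfl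
        (isFloat_of_onGrid_two_zpow hp ((onGrid_exact l hgl).add (onGrid_exact r hgr)) (by linarith) hj)

/-- Eq. (2.20), first inequality, in any order: `n·eps ≤ 1`, `aᵢ ∈ F`, `|aᵢ| ≤ σ'` (`σ' = 2^j ≥ eta`)
⟹ `|fl(Σ aᵢ)| ≤ n·σ'` ("Otherwise `neps ≤ 1` implies `nσ' ∈ F`, and (2.6) proves `|fl(s̃ + aₖ)| ≤ nσ'`";
induction over the evaluation tree). [cite: RumpOgitaOishi2008, §2 eq. (2.20)] -/
theorem abs_eval_le_length_mul (hp : 1 ≤ p) (hfl : IsRoundNearest p emin fl) {j : ℤ} (hj : emin ≤ j) :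
    ∀ t : SumTree, (∀ a ∈ t.leaves, IsFloat p emin a ∧ |a| ≤ (2 : ℚ) ^ j) → t.leaves.length ≤ 2 ^ p →
      |t.eval fl| ≤ (t.leaves.length : ℚ) * (2 : ℚ) ^ j
  | .leaf a, h, _ => by simpa [eval, leaves] using (h a (by simp [leaves])).2
  | .node l r, h, hn => by
      have hl' : ∀ a ∈ l.leaves, IsFloat p emin a ∧ |a| ≤ (2 : ℚ) ^ j :=
        fun a ha => h a (by simp [leaves, ha])
      have hr' : ∀ a ∈ r.leaves, IsFloat p emin a ∧ |a| ≤ (2 : ℚ) ^ j :=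
        fun a ha => h a (by simp [leaves, ha])
      have hlen : (SumTree.node l r).leaves.length = l.leaves.length + r.leaves.length := by
        simp [leaves]
      rw [hlen] at hn ⊢
      have hl := abs_eval_le_length_mul hp hfl hj l hl' (by omega)
      have hr := abs_eval_le_length_mul hp hfl hj r hr' (by omega)
      simp only [eval]
      have hB : IsFloat p emin ((((l.leaves.length + r.leaves.length : ℕ) : ℤ) : ℚ) * (2 : ℚ) ^ j) := by
        refine isFloat_of_abs_le hp ?_ hj
        rw [abs_of_nonneg (by positivity)]; exact_mod_cast hn
      have hcast : (((l.leaves.length + r.leaves.length : ℕ) : ℤ) : ℚ) =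
          (l.leaves.length : ℚ) + (r.leaves.length : ℚ) := by push_cast; ring
      rw [hcast] at hB
      have hsum : |eval fl l + eval fl r| ≤ ((l.leaves.length : ℚ) + (r.leaves.length : ℚ)) * (2 : ℚ) ^ j := by
        calc |eval fl l + eval fl r| ≤ |eval fl l| + |eval fl r| := abs_add_le _ _
          _ ≤ (l.leaves.length : ℚ) * (2 : ℚ) ^ j + (r.leaves.length : ℚ) * (2 : ℚ) ^ j := add_le_add hl hr
          _ = ((l.leaves.length : ℚ) + (r.leaves.length : ℚ)) * (2 : ℚ) ^ j := by ring
      obtain ⟨hlo, hhi⟩ := abs_le.mp hsum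
      have h1 := fl_le_of_le hfl hB hhi
      have h2 := le_fl_of_le hfl hB.neg (t := eval fl l + eval fl r) (by linarith)
      push_cast
      rw [abs_le]; constructor <;> linarith

/-- A floating-point sum of zeros is zero, in any order (`fl(0 + 0) = 0`).
[cite: RumpOgitaOishi2008, proof of Theorem 3.5 ("all p′ᵢ are zero and the assertion is trivial")] -/
theorem eval_eq_zero_of_leaves (hfl : IsRoundNearest p emin fl) :
    ∀ t : SumTree, (∀ a ∈ t.leaves, a = 0) → t.eval fl = 0
  | .leaf a, h => by simpa [eval] using h a (by simp [leaves])
  | .node l r, h => by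
      simp only [eval]
      rw [eval_eq_zero_of_leaves hfl l fun a ha => h a (by simp [leaves, ha]),
        eval_eq_zero_of_leaves hfl r fun a ha => h a (by simp [leaves, ha]), add_zero, fl_zero hfl]

/-- The evaluation tree of a left-to-right accumulation loop `τ = fl(τ + qᵢ)` started from a tree `t`
(for Algorithm 3.4: `t = leaf 0`, the initial `τ = 0`). [cite: RumpOgitaOishi2008, Algorithm 3.4] -/
def accTree : SumTree → List ℚ → SumTree
  | t, [] => t
  | t, q :: qs => accTree (SumTree.node t (SumTree.leaf q)) qs

/-- The loop `τ = fl(τ + qᵢ)` evaluates `accTree`. [cite: RumpOgitaOishi2008, Algorithm 3.4] -/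
theorem eval_accTree (fl : ℚ → ℚ) :
    ∀ (t : SumTree) (qs : List ℚ), (accTree t qs).eval fl = qs.foldl (fun τ q => fl (τ + q)) (t.eval fl)
  | _, [] => rfl
  | t, q :: qs => by rw [accTree, eval_accTree fl (SumTree.node t (SumTree.leaf q)) qs]; rfl

/-- The exact value of `accTree`. [cite: RumpOgitaOishi2008, Algorithm 3.4] -/
theorem exact_accTree : ∀ (t : SumTree) (qs : List ℚ), (accTree t qs).exact = t.exact + qs.sum
  | t, [] => by simp [accTree]
  | t, q :: qs => by rw [accTree, exact_accTree]; simp [exact]; ring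

/-- The leaves of `accTree`. [cite: RumpOgitaOishi2008, Algorithm 3.4] -/
theorem leaves_accTree : ∀ (t : SumTree) (qs : List ℚ), (accTree t qs).leaves = t.leaves ++ qs
  | t, [] => by simp [accTree]
  | t, q :: qs => by rw [accTree, leaves_accTree]; simp [leaves]

/-- Splitting a list sum termwise: if `x = f x + g x` on `l` then `Σ x = Σ f x + Σ g x`.
[cite: RumpOgitaOishi2008, Theorem 3.5 eq. (3.3) (Σ pᵢ = τ + Σ p′ᵢ)] -/
theorem list_sum_eq_of_forall_eq_add {f g : ℚ → ℚ} :
    ∀ {l : List ℚ}, (∀ x ∈ l, x = f x + g x) → l.sum = (l.map f).sum + (l.map g).sum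
  | [], _ => by simp
  | a :: l, h => by
      simp only [List.sum_cons, List.map_cons]
      rw [list_sum_eq_of_forall_eq_add (l := l) fun x hx => h x (by simp [hx])]
      have ha := h a (by simp)
      linarith

/-! ### Algorithm 3.4 `ExtractVector` and Theorem 3.5 -/

/-- **Algorithm 3.4** `[τ, p′] = ExtractVector(σ, p)`: `τ = 0; for i = 1 : n, [qᵢ, p′ᵢ] = ExtractScalar(σ, pᵢ);
τ = fl(τ + qᵢ); end` — returns the accumulated high parts `τ` and the vector of low parts.
[cite: RumpOgitaOishi2008, Algorithm 3.4] -/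
def extractVector (fl : ℚ → ℚ) (σ : ℚ) (xs : List ℚ) : ℚ × List ℚ :=
  ((xs.map fun x => (extractScalar fl σ x).1).foldl (fun τ q => fl (τ + q)) 0,
    xs.map fun x => (extractScalar fl σ x).2)

/-- The components of `ExtractVector`. [cite: RumpOgitaOishi2008, Algorithm 3.4] -/
theorem extractVector_eq (fl : ℚ → ℚ) (σ : ℚ) (xs : List ℚ) :
    extractVector fl σ xs = ((xs.map fun x => (extractScalar fl σ x).1).foldl (fun τ q => fl (τ + q)) 0,
      xs.map fun x => (extractScalar fl σ x).2) := rfl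

/-- The accumulation `τ` of Algorithm 3.4 is the floating-point evaluation of the left comb on `0, q₁, …, qₙ`.
[cite: RumpOgitaOishi2008, Algorithm 3.4] -/
theorem extractVector_fst_eq_eval (fl : ℚ → ℚ) (σ : ℚ) (xs : List ℚ) :
    (extractVector fl σ xs).1 =
      (accTree (SumTree.leaf 0) (xs.map fun x => (extractScalar fl σ x).1)).eval fl := by
  rw [eval_accTree]; rfl

/-- **THEOREM 3.5, eq. (3.3): `ExtractVector` is an error-free vector transformation.** Let `σ = 2^k ∈ F`
(`k ≥ emin`), `x₁, …, xₙ ∈ F` with `|xᵢ| ≤ 2^-M σ`, `n < 2^M`, and `M < p` (`2^M·eps < 1`, see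
`abs_extractScalar_fst_le`; automatic under (3.4)'s `2^(2M)eps ≤ 1`). Then with `[τ, x′] = ExtractVector(σ, x)`:
`Σ xᵢ = τ + Σ x′ᵢ`, `max |x′ᵢ| ≤ eps·σ`, `|τ| ≤ n·2^-M σ < σ`, `τ ∈ epsσℤ` — and `τ = Σ qᵢ` EXACTLY, `τ ∈ F`.
Precision `p ≥ 1`, gradual underflow, any tie rule, no overflow in this model.
[cite: RumpOgitaOishi2008, Theorem 3.5 eq. (3.3)] -/
theorem extractVector_eft (hp : 1 ≤ p) (hfl : IsRoundNearest p emin fl) {k : ℤ} (hk : emin ≤ k)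
    {M : ℕ} (hM : M < p) {xs : List ℚ} (hxs : ∀ x ∈ xs, IsFloat p emin x ∧ |x| ≤ (2 : ℚ) ^ k / 2 ^ M)
    (hn : xs.length < 2 ^ M) :
    xs.sum = (extractVector fl ((2 : ℚ) ^ k) xs).1 + ((extractVector fl ((2 : ℚ) ^ k) xs).2).sum ∧
      (∀ x' ∈ (extractVector fl ((2 : ℚ) ^ k) xs).2, |x'| ≤ unitRoundoff p * (2 : ℚ) ^ k) ∧
      |(extractVector fl ((2 : ℚ) ^ k) xs).1| ≤ (xs.length : ℚ) * ((2 : ℚ) ^ k / 2 ^ M) ∧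
      (xs.length : ℚ) * ((2 : ℚ) ^ k / 2 ^ M) < (2 : ℚ) ^ k ∧
      OnGrid (unitRoundoff p * (2 : ℚ) ^ k) (extractVector fl ((2 : ℚ) ^ k) xs).1 ∧
      (extractVector fl ((2 : ℚ) ^ k) xs).1 = (xs.map fun x => (extractScalar fl ((2 : ℚ) ^ k) x).1).sum ∧
      IsFloat p emin (extractVector fl ((2 : ℚ) ^ k) xs).1 := by
  set σ : ℚ := (2 : ℚ) ^ k with hσ
  set q : ℚ → ℚ := fun x => (extractScalar fl σ x).1 with hq
  set lo : ℚ → ℚ := fun x => (extractScalar fl σ x).2 with hlo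
  have hσpos : 0 < σ := two_zpow_pos k
  have hdiv : σ / 2 ^ M = (2 : ℚ) ^ (k - M) := by
    rw [hσ, zpow_sub₀ (by norm_num : (2 : ℚ) ≠ 0), zpow_natCast]
  have hσk : σ = (2 : ℚ) ^ M * (2 : ℚ) ^ (k - M) := by
    rw [hσ, ← zpow_natCast, ← zpow_add₀ (by norm_num : (2 : ℚ) ≠ 0)]; congr 1; ring
  -- Lemma 3.3 for every entry
  have H : ∀ x ∈ xs, x = q x + lo x ∧ |lo x| ≤ unitRoundoff p * σ ∧ OnGrid (unitRoundoff p * σ) (q x) ∧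
      |q x| ≤ (2 : ℚ) ^ (k - M) ∧ IsFloat p emin (q x) ∧ IsFloat p emin (lo x) := by
    intro x hx
    obtain ⟨hxF, hxM⟩ := hxs x hx
    have hxs' : |x| ≤ σ := hxM.trans (div_le_self hσpos.le (one_le_pow₀ (by norm_num)))
    obtain ⟨-, -, h3, h4, h5⟩ := extractScalar_eft hp hfl hk hxF hxs'
    have h6 := abs_extractScalar_fst_le hp hfl hk hxF hM hxM
    rw [hdiv] at h6
    exact ⟨h3, h4, h5, h6, (isFloat_extractScalar hfl σ x).1, (isFloat_extractScalar hfl σ x).2⟩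
  -- the accumulation is exact: `τ = Σ qᵢ`
  have hn' : (xs.length : ℚ) * (2 : ℚ) ^ (k - M) < σ := by
    have : (xs.length : ℚ) < (2 : ℚ) ^ M := by exact_mod_cast hn
    rw [hσk]; exact mul_lt_mul_of_pos_right this (two_zpow_pos _)
  have hsumabs : ((xs.map q).map abs).sum ≤ (xs.length : ℚ) * (2 : ℚ) ^ (k - M) := by
    have h := List.sum_le_card_nsmul ((xs.map q).map abs) ((2 : ℚ) ^ (k - M)) (by
      intro y hy
      obtain ⟨z, hz, rfl⟩ := List.mem_map.mp hy
      obtain ⟨x, hx, rfl⟩ := List.mem_map.mp hz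
      exact (H x hx).2.2.2.1)
    simpa [nsmul_eq_mul] using h
  have hτ : (extractVector fl σ xs).1 = (xs.map q).sum := by
    rw [extractVector_fst_eq_eval]
    have key := eval_eq_exact_of_onGrid hp hfl (j := max emin (k - p)) (le_max_left _ _)
      (accTree (SumTree.leaf 0) (xs.map q)) ?_ ?_
    · rw [key, exact_accTree]; simp [exact]
    · intro a ha
      rw [leaves_accTree] at ha
      simp only [leaves, List.singleton_append, List.mem_cons, List.mem_map] at ha
      rcases ha with rfl | ⟨x, hx, rfl⟩
      · exact onGrid_zero _
      · rcases le_total emin (k - p) with h | h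
        · rw [max_eq_right h]
          have := (H x hx).2.2.1; rwa [u_mul_two_zpow] at this
        · rw [max_eq_left h]; exact onGrid_eta_of_isFloat (H x hx).2.2.2.2.1
    · have hbound : (2 : ℚ) ^ k ≤ (2 : ℚ) ^ p * (2 : ℚ) ^ max emin (k - p) := by
        calc (2 : ℚ) ^ k = (2 : ℚ) ^ p * (2 : ℚ) ^ (k - p) := by
              rw [← zpow_natCast, ← zpow_add₀ (by norm_num : (2 : ℚ) ≠ 0)]; congr 1; ring
          _ ≤ (2 : ℚ) ^ p * (2 : ℚ) ^ max emin (k - p) :=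
              mul_le_mul_of_nonneg_left (zpow_le_zpow_right₀ (by norm_num) (le_max_right _ _))
                (by positivity)
      refine le_trans ?_ hbound
      simp only [absSum, leaves_accTree, leaves, List.singleton_append, List.map_cons, abs_zero,
        List.sum_cons, zero_add]
      exact hsumabs.trans (by rw [hσ] at hn'; exact hn'.le)
  refine ⟨?_, ?_, ?_, by rwa [hdiv], ?_, hτ, ?_⟩
  · -- `Σ xᵢ = τ + Σ x′ᵢ`
    rw [hτ]
    exact list_sum_eq_of_forall_eq_add fun x hx => (H x hx).1
  · -- `max |x′ᵢ| ≤ eps·σ`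
    intro x' hx'
    obtain ⟨x, hx, rfl⟩ := List.mem_map.mp hx'
    exact (H x hx).2.1
  · -- `|τ| ≤ n·2^-M σ`
    rw [hτ, hdiv]
    exact (abs_list_sum_le _).trans hsumabs
  · -- `τ ∈ epsσℤ`
    rw [hτ]
    exact onGrid_list_sum fun y hy => by
      obtain ⟨x, hx, rfl⟩ := List.mem_map.mp hy
      exact (H x hx).2.2.1
  · -- `τ ∈ F`
    rw [extractVector_fst_eq_eval]
    refine isFloat_eval hfl _ fun a ha => ?_
    rw [leaves_accTree] at ha
    simp only [leaves, List.singleton_append, List.mem_cons, List.mem_map] at ha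
    rcases ha with rfl | ⟨x, hx, rfl⟩
    · exact isFloat_zero p emin
    · exact (H x hx).2.2.2.2.1

/-- **THEOREM 3.5, eq. (3.4).** If `2^(2M)·eps ≤ 1` (i.e. `2M ≤ p`), then `|fl(τ + T)| < σ` for
`T := fl(Σ x′ᵢ)` computed in ANY order (so the next extraction of `AccSum` may use the same `σ`-scale):
`|T| ≤ n·epsσ` by (2.20), `|τ + T| ≤ (2^M − 1)(2^-M + eps)σ ≤ (1 − eps)σ = pred(σ) ∈ F`, and (2.6); when
`epsσ < eta` all `x′ᵢ` vanish and `fl(τ + T) = τ`. [cite: RumpOgitaOishi2008, Theorem 3.5 eq. (3.4)] -/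
theorem abs_fl_extractVector_fst_add_lt (hp : 1 ≤ p) (hfl : IsRoundNearest p emin fl) {k : ℤ}
    (hk : emin ≤ k) {M : ℕ} (hM2 : 2 * M ≤ p) {xs : List ℚ}
    (hxs : ∀ x ∈ xs, IsFloat p emin x ∧ |x| ≤ (2 : ℚ) ^ k / 2 ^ M) (hn : xs.length < 2 ^ M)
    (t : SumTree) (ht : t.leaves = (extractVector fl ((2 : ℚ) ^ k) xs).2) :
    |fl ((extractVector fl ((2 : ℚ) ^ k) xs).1 + t.eval fl)| < (2 : ℚ) ^ k := by
  have hM : M < p := by omega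
  obtain ⟨-, hlo, hτabs, hnlt, -, -, hτF⟩ := extractVector_eft hp hfl hk hM hxs hn
  set τ := (extractVector fl ((2 : ℚ) ^ k) xs).1 with hτdef
  have hdiv : (2 : ℚ) ^ k / 2 ^ M = (2 : ℚ) ^ (k - M) := by
    rw [zpow_sub₀ (by norm_num : (2 : ℚ) ≠ 0), zpow_natCast]
  rw [hdiv] at hτabs hnlt
  have hleavesF : ∀ a ∈ t.leaves, IsFloat p emin a ∧ |a| ≤ (2 : ℚ) ^ (k - p) := by
    intro a ha
    rw [ht] at ha
    refine ⟨?_, by have := hlo a ha; rwa [u_mul_two_zpow] at this⟩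
    obtain ⟨x, -, rfl⟩ := List.mem_map.mp ha
    exact (isFloat_extractScalar hfl _ x).2
  rcases lt_or_ge (k - (p : ℤ)) emin with hlt | hge
  · -- `epsσ < eta`: every `x′ᵢ` is `0`, `T = 0`, `fl(τ + 0) = τ`
    have hT : t.eval fl = 0 := eval_eq_zero_of_leaves hfl t fun a ha =>
      eq_zero_of_isFloat_of_abs_lt (hleavesF a ha).1
        ((hleavesF a ha).2.trans_lt (zpow_lt_zpow_right₀ (by norm_num) hlt))
    rw [hT, add_zero, fl_eq_self hfl hτF]
    exact hτabs.trans_lt hnlt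
  · -- `|T| ≤ n·epsσ` by (2.20), and `pred(σ) = (2^p − 1)·2^(k−p) ∈ F` bounds `|τ + T|`
    have hlen : t.leaves.length = xs.length := by rw [ht, extractVector_eq]; simp
    have hMp : 2 ^ M ≤ 2 ^ p := Nat.pow_le_pow_right (by norm_num) hM.le
    have hT := abs_eval_le_length_mul hp hfl hge t hleavesF (by rw [hlen]; omega)
    rw [hlen] at hT
    have hP : IsFloat p emin ((((2 : ℤ) ^ p - 1 : ℤ) : ℚ) * (2 : ℚ) ^ (k - p)) := by
      refine isFloat_of_int_mul _ _ ?_ hge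
      have h1 : (1 : ℤ) ≤ 2 ^ p := one_le_pow₀ (by norm_num)
      rw [abs_of_nonneg (by omega)]; omega
    have hPeq : (((2 : ℤ) ^ p - 1 : ℤ) : ℚ) * (2 : ℚ) ^ (k - p) = (2 : ℚ) ^ k - (2 : ℚ) ^ (k - p) := by
      have : (2 : ℚ) ^ k = (2 : ℚ) ^ p * (2 : ℚ) ^ (k - p) := by
        rw [← zpow_natCast, ← zpow_add₀ (by norm_num : (2 : ℚ) ≠ 0)]; congr 1; ring
      rw [this]; push_cast; ring
    rw [hPeq] at hP
    -- arithmetic: n(2^(k-M) + 2^(k-p)) ≤ 2^k − 2^(k−p) using n ≤ 2^M − 1 and 2^M·2^(k−p) ≤ 2^(k−M)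
    have hnle : (xs.length : ℚ) ≤ (2 : ℚ) ^ M - 1 := by
      have : xs.length + 1 ≤ 2 ^ M := hn
      have : ((xs.length + 1 : ℕ) : ℚ) ≤ ((2 ^ M : ℕ) : ℚ) := by exact_mod_cast this
      push_cast at this; linarith
    have hσk : (2 : ℚ) ^ k = (2 : ℚ) ^ M * (2 : ℚ) ^ (k - M) := by
      rw [← zpow_natCast, ← zpow_add₀ (by norm_num : (2 : ℚ) ≠ 0)]; congr 1; ring
    have hMM : (2 : ℚ) ^ M * (2 : ℚ) ^ (k - p) ≤ (2 : ℚ) ^ (k - M) := by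
      rw [← zpow_natCast, ← zpow_add₀ (by norm_num : (2 : ℚ) ≠ 0)]
      exact zpow_le_zpow_right₀ (by norm_num) (by omega)
    have hA : 0 ≤ (2 : ℚ) ^ (k - M) := (two_zpow_pos _).le
    have hB : 0 ≤ (2 : ℚ) ^ (k - p) := (two_zpow_pos _).le
    have hbound : |τ + t.eval fl| ≤ (2 : ℚ) ^ k - (2 : ℚ) ^ (k - p) := by
      calc |τ + t.eval fl| ≤ |τ| + |t.eval fl| := abs_add_le _ _
        _ ≤ (xs.length : ℚ) * (2 : ℚ) ^ (k - M) + (xs.length : ℚ) * (2 : ℚ) ^ (k - p) := add_le_add hτabs hT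
        _ ≤ ((2 : ℚ) ^ M - 1) * (2 : ℚ) ^ (k - M) + ((2 : ℚ) ^ M - 1) * (2 : ℚ) ^ (k - p) := by
            gcongr
        _ = (2 : ℚ) ^ k - (2 : ℚ) ^ (k - M) + ((2 : ℚ) ^ M * (2 : ℚ) ^ (k - p) - (2 : ℚ) ^ (k - p)) := by
            rw [hσk]; ring
        _ ≤ (2 : ℚ) ^ k - (2 : ℚ) ^ (k - p) := by linarith
    obtain ⟨hlo', hhi'⟩ := abs_le.mp hbound
    have h1 := fl_le_of_le hfl hP hhi'
    have h2 := le_fl_of_le hfl hP.neg (t := τ + t.eval fl) (by linarith)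
    have hpos : 0 < (2 : ℚ) ^ (k - p) := two_zpow_pos _
    rw [abs_lt]; constructor <;> linarith

end Literature.ComputerArithmetic.RumpOgitaOishi2008
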